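import Summits.NavierStokesRegularity.OSWSelfSimilar.SheetRLinearisedStability
import Summits.NavierStokesRegularity.OSWSelfSimilar.SheetRSpectrumOddAssembly
import HarnessLib

/-!
# SHEET-ℝ, Z3-SR-SPEC: «linearly stable modulo gauge» FROM THE S2 INTERFACE OF RECORD (certificate + far field + one weak eigenvector)

HONEST FRAMING (cell ns-blowup GROUP B / zone Z3, case Z3-SR-SPEC; renewal route, memo `HOME/profile/cert/cert5/P9-P10-RENEWAL-DESIGN.md` v2; 0 kit;
1-D MODEL certificate frame; not Euler/NS; «violates: none — MODEL»). NOTHING here asserts that a hypothesis holds.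

`SheetRLinearisedStability.flow_sub_gaugeMode_le_of_chain` states the word modulo three sentences about the Evans function `E = evansOdd hL K h ℓ f θ`:
no zero on `{Re σ > −β₀} ∖ {1}`, `E 1 = 0`, `E′(1) ≠ 0`. This file derives THOSE three from the S2 interface of record used by selfsim's
`SheetRSpectrumOddAssembly.weakEigen_set_eq_singleton` — implementation 2's `RectLabelCertificate E` on `K = [−3/100, 12] × [−12, 12]`, the far-field
exclusion `E ≠ 0` for `Re σ > −3/100`, `‖σ‖ > 1141/100`, and ONE non-trivial weak eigenvector at `σ = 1` (cert-5's (P6) transport of the time-shift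
mode) — with `β₀ = 3/100` (`evansOdd_sentences_of_certificate`), and restates the word on that interface (`flow_sub_gaugeMode_le_of_certificate`):
for the (S1) datum with `m > 3/100`, the (P9) generator data, the far-field chain `a` (which also gives `f ∈ D(T)`), the certificate, the far field and
the weak eigenvector: **∀ 0 < β′ < 3/100 ∃ M ∀ δ₀ ∀ t ≥ 0, ‖S_F(t)δ₀ − (θℓ(R_K(1)δ₀)/E′(1))·e^{t}•R_K(1)f‖ ≤ M‖δ₀‖e^{−β′t}.**
WHAT THIS IS NOT: not NS; no interval arithmetic; no number of record moves; hypotheses as in `SheetRSpectrumEndToEnd` plus the (P9) generator data.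
-/

noncomputable section

namespace Summit.NavierStokesRegularity.OSWSelfSimilar
namespace SheetRLinearisedStabilityRecord

open _root_.MeasureTheory _root_.Set _root_.Filter _root_.Complex SheetREnergySpace SheetRComplexPivot SheetRPerturbedResolventC SheetROddClass
  SheetRResolventOddClass SheetRGeneratorOddWeak SheetREvansOdd SheetRLinearisedSemigroup SheetRLinearisedFlow SheetRLinearisedRenewal
  SheetRSpectrumWindingLists SheetRSpectrumOddAssembly SheetRLinearisedStability
  Literature.Analysis.OperatorTheory Literature.Analysis.UnboundedOperators Literature.Analysis.Complex Literature.Analysis.Convolution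
open scoped Topology NNReal

variable {L D₀ D₁ V₀ c m : ℝ} {d V : ℝ → ℝ}

/-- An analytic function with a zero of order one has non-vanishing derivative there (Mathlib's `analyticOrderAt_deriv_add_one`). [folklore] -/
theorem deriv_ne_zero_of_order_one {E : ℂ → ℂ} {z₀ : ℂ} (hE : AnalyticAt ℂ E z₀) (h0 : E z₀ = 0) (h1 : analyticOrderAt E z₀ = 1) :
    deriv E z₀ ≠ 0 := by
  have h := hE.analyticOrderAt_deriv_add_one
  have hsub : (fun z => E z - E z₀) = E := by funext z; rw [h0, sub_zero]
  rw [hsub, h1] at h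
  have h2 : analyticOrderAt (deriv E) z₀ = 0 := by
    have h3 : analyticOrderAt (deriv E) z₀ + 1 = 0 + 1 := by rw [h, zero_add]
    exact WithTop.add_right_cancel (by exact WithTop.one_ne_top) h3
  rcases (hE.deriv.analyticOrderAt_eq_zero).1 h2 with h4
  exact h4

/-- **The three Evans-function sentences from the S2 interface of record** (`β₀ = 3/100`): under the (S1) datum with `−m < −3/100`, the label
certificate, the far-field exclusion and one non-trivial weak eigenvector at `1`: `E ≠ 0` on `{Re σ > −3/100} ∖ {1}`, `E 1 = 0`, `E′(1) ≠ 0`.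
[folklore] -/
theorem evansOdd_sentences_of_certificate (hL : 0 < L) (K : Esp L hL →L[ℝ] W L) (h : GardingDataKC L hL d V K D₀ D₁ V₀ c m)
    (hm : -m < ra) (ℓ : Wcodd L →L[ℂ] ℂ) (f : Wcodd L) (θ : ℂ)
    (hcert : RectLabelCertificate (evansOdd hL K h ℓ f θ))
    (hfar : ∀ σ : ℂ, ra < σ.re → (1141 : ℝ) / 100 < ‖σ‖ → evansOdd hL K h ℓ f θ σ ≠ 0)
    {v : Wcodd L} (hv0 : v ≠ 0) (hv : IsWeakEigen hL K d V ℓ f θ 1 v) :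
    (∀ σ : ℂ, -((3 : ℝ) / 100) < σ.re → σ ≠ 1 → evansOdd hL K h ℓ f θ σ ≠ 0) ∧
      evansOdd hL K h ℓ f θ 1 = 0 ∧ deriv (evansOdd hL K h ℓ f θ) 1 ≠ 0 := by
  have hra1 : ra < 1 := by norm_num [ra]
  have h1m : -m < (1 : ℂ).re := by rw [Complex.one_re]; linarith
  have hE1 : evansOdd hL K h ℓ f θ 1 = 0 := (exists_weakEigen_iff_evansOdd_eq_zero hL K h ℓ f θ h1m).1 ⟨v, hv0, hv⟩
  have han := analyticOnNhd_evansOdd_rect hL K h hm ℓ f θ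
  obtain ⟨honly, horder⟩ := eq_one_of_zero_and_order_one han hcert hE1
  refine ⟨fun σ hσ hσ1 hE => hσ1 ?_, hE1, ?_⟩
  · have hσ' : ra < σ.re := by rw [ra]; linarith
    by_cases hn : ‖σ‖ ≤ (1141 : ℝ) / 100
    · exact honly σ (halfDisc_subset_rect hσ' hn) hE
    · exact absurd hE (hfar σ hσ' (not_le.1 hn))
  · have h1K : (1 : ℂ) ∈ Icc ra rb ×ℂ Icc rc rd := by
      rw [Complex.mem_reProdIm]; constructor <;> constructor <;> norm_num [ra, rb, rc, rd]
    exact deriv_ne_zero_of_order_one (han 1 h1K) hE1 horder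

/-- **«LINEARLY STABLE MODULO GAUGE» (MODEL) ON THE S2 INTERFACE OF RECORD.** Hypotheses: the (S1) datum `h` with `−m < −3/100`; the (P9) generator
data of `exists_c0Semigroup` / `exists_c0Semigroup_full` on a pair `S`, `S_F`; the far-field chain `a` of record (`a 0 = f`, `a j = R_K(z)(a (j+1) + z a j)`,
`j < 3` — gives `f ∈ D(T)`); implementation 2's `RectLabelCertificate` for `E`; the far-field exclusion; one weak eigenvector `v ≠ 0` at `σ = 1`. Then
∀ `0 < β′ < 3/100` ∃ `M` ∀ `δ₀` ∀ `t ≥ 0`: `‖S_F(t)δ₀ − (θℓ(R_K(1)δ₀)/E′(1))·e^{t}•R_K(1)f‖ ≤ M‖δ₀‖e^{−β′t}`. 1-D MODEL; NOT NS; nothing is asserted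
to hold. [folklore] -/
theorem flow_sub_gaugeMode_le_of_certificate (hL : 0 < L) (K : Esp L hL →L[ℝ] W L) (h : GardingDataKC L hL d V K D₀ D₁ V₀ c m)
    (hm : -m < ra) {σ₀ : ℂ} (hσ₀ : -m < σ₀.re)
    (ℓ : Wcodd L →L[ℂ] ℂ) (f : Wcodd L) (θ : ℂ) (S SF : C0Semigroup ℂ (Wcodd L))
    (hS : S.generator = generatorOdd hL K h σ₀ hσ₀) (hSM : ∀ τ : ℝ≥0, ‖S.app τ‖ ≤ Real.exp (-m * τ))
    (hlap : ∀ σ : ℂ, -m < σ.re → ∀ G : Wcodd L, S.laplaceResolventFun σ G = resolventOdd hL K h σ G)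
    (hdomF : (SF.generator.domain : Set (Wcodd L)) = (generatorOdd hL K h σ₀ hσ₀).domain)
    (hgenF : ∀ (u : Wcodd L) (hu : u ∈ (generatorOdd hL K h σ₀ hσ₀).domain), ∃ hu' : u ∈ SF.generator.domain,
      SF.generator ⟨u, hu'⟩ = generatorOdd hL K h σ₀ hσ₀ ⟨u, hu⟩ + (θ * ℓ u) • f)
    {z : ℂ} (hz : -m < z.re) {a : ℕ → Wc L} (ha0 : a 0 = (f : Wc L))
    (hchain : ∀ j < 3, a j = resolventKC hL K h z (a (j + 1) + z • a j))
    (hcert : RectLabelCertificate (evansOdd hL K h ℓ f θ))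
    (hfar : ∀ σ : ℂ, ra < σ.re → (1141 : ℝ) / 100 < ‖σ‖ → evansOdd hL K h ℓ f θ σ ≠ 0)
    {v : Wcodd L} (hv0 : v ≠ 0) (hv : IsWeakEigen hL K d V ℓ f θ 1 v)
    {β' : ℝ} (hβ' : 0 < β') (hβ'3 : β' < (3 : ℝ) / 100) :
    ∃ M : ℝ, ∀ (δ₀ : Wcodd L) (t : ℝ), 0 ≤ t →
      ‖SF.app t.toNNReal δ₀ -
        ((deriv (evansOdd hL K h ℓ f θ) 1)⁻¹ * (θ * ℓ (resolventOdd hL K h 1 δ₀)) * cexp t) • resolventOdd hL K h 1 f‖ ≤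
        M * ‖δ₀‖ * Real.exp (-β' * t) := by
  obtain ⟨hzero, hE1, hE'1⟩ := evansOdd_sentences_of_certificate hL K h hm ℓ f θ hcert hfar hv0 hv
  have hm3 : (3 : ℝ) / 100 ≤ m := by rw [ra] at hm; linarith
  have hm0 : 0 < m := by linarith
  exact flow_sub_gaugeMode_le_of_chain hL K h hσ₀ hm0 ℓ f θ S SF hS hSM hlap hdomF hgenF hz ha0 hchain
    (β₀ := (3 : ℝ) / 100) (by norm_num) hm3 hβ' hβ'3 hzero hE1 hE'1

/-- **THE LINEARISED FLOW EXISTS AND IS LINEARLY STABLE MODULO GAUGE (MODEL)** — existence form: the two (P9) semigroups are PRODUCED (selfsim's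
`exists_c0Semigroup` / `exists_c0Semigroup_full` under the (S1) datum alone; unique by `C0Semigroup.eq_of_generator_eq`) and the word of
`flow_sub_gaugeMode_le_of_certificate` holds for them. Hypotheses = the (S1) datum with `−m < −3/100`, the S2 interface of record (label certificate, far
field, one weak eigenvector at `1`) and the far-field chain `a`. 1-D MODEL; NOT NS; nothing is asserted to hold. [folklore] -/
theorem exists_flow_sub_gaugeMode_le_of_certificate (hL : 0 < L) (K : Esp L hL →L[ℝ] W L) (h : GardingDataKC L hL d V K D₀ D₁ V₀ c m)
    (hm : -m < ra) (ℓ : Wcodd L →L[ℂ] ℂ) (f : Wcodd L) (θ : ℂ)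
    {z : ℂ} (hz : -m < z.re) {a : ℕ → Wc L} (ha0 : a 0 = (f : Wc L))
    (hchain : ∀ j < 3, a j = resolventKC hL K h z (a (j + 1) + z • a j))
    (hcert : RectLabelCertificate (evansOdd hL K h ℓ f θ))
    (hfar : ∀ σ : ℂ, ra < σ.re → (1141 : ℝ) / 100 < ‖σ‖ → evansOdd hL K h ℓ f θ σ ≠ 0)
    {v : Wcodd L} (hv0 : v ≠ 0) (hv : IsWeakEigen hL K d V ℓ f θ 1 v)
    {β' : ℝ} (hβ' : 0 < β') (hβ'3 : β' < (3 : ℝ) / 100) :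
    ∃ (S SF : C0Semigroup ℂ (Wcodd L)) (hσ₀ : -m < (((‖(θ • ℓ).smulRight f‖ : ℝ) : ℂ)).re),
      S.generator = generatorOdd hL K h _ hσ₀ ∧ (∀ τ : ℝ≥0, ‖S.app τ‖ ≤ Real.exp (-m * τ)) ∧
      (∀ σ : ℂ, -m < σ.re → ∀ G : Wcodd L, S.laplaceResolventFun σ G = resolventOdd hL K h σ G) ∧
      ((SF.generator.domain : Set (Wcodd L)) = (generatorOdd hL K h _ hσ₀).domain) ∧
      (∀ (u : Wcodd L) (hu : u ∈ (generatorOdd hL K h _ hσ₀).domain), ∃ hu' : u ∈ SF.generator.domain,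
        SF.generator ⟨u, hu'⟩ = generatorOdd hL K h _ hσ₀ ⟨u, hu⟩ + (θ * ℓ u) • f) ∧
      ∃ M : ℝ, ∀ (δ₀ : Wcodd L) (t : ℝ), 0 ≤ t →
        ‖SF.app t.toNNReal δ₀ -
          ((deriv (evansOdd hL K h ℓ f θ) 1)⁻¹ * (θ * ℓ (resolventOdd hL K h 1 δ₀)) * cexp t) • resolventOdd hL K h 1 f‖ ≤
          M * ‖δ₀‖ * Real.exp (-β' * t) := by
  have hm0 : 0 < m := by have : ra < 0 := by norm_num [ra]
                         linarith
  set b : ℝ := ‖(θ • ℓ).smulRight f‖ with hb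
  have hσ₀b : b - m < ((b : ℂ)).re := by simp; linarith
  obtain ⟨hσ₀, SF, -, -, hdomF, hgenF⟩ := exists_c0Semigroup_full hL K h ℓ f θ (b := b) le_rfl hσ₀b
  obtain ⟨S, hSM, hlap, hS⟩ := exists_c0Semigroup hL K h hσ₀
  obtain ⟨M, hM⟩ := flow_sub_gaugeMode_le_of_certificate hL K h hm hσ₀ ℓ f θ S SF hS hSM hlap hdomF hgenF hz ha0 hchain
    hcert hfar hv0 hv hβ' hβ'3
  exact ⟨S, SF, hσ₀, hS, hSM, hlap, hdomF, hgenF, M, hM⟩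

end SheetRLinearisedStabilityRecord
end Summit.NavierStokesRegularity.OSWSelfSimilar
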